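import Mathlib
import Literature.Geometry.DiscreteGeometry.DelaunaySubdivision
import Summits.AtomisticToContinuum.Crystallization.Theorems.SquareWellLayerCakeAveragedTwelveTwoCells
import HarnessLib

/-!
# Stub `stub_edgeValence` of line `Sketch` (idea par-five-delaunay-recount) of crux
`SquareWellLayerCake.AveragedTwelve` (stmt-AtomisticToContinuum-15806)

EDGE VALENCE = SIZE OF THE EDGE LINK.  `K` triangulates the finite site set `ω ⊂ ℝ³`
(`Literature.Geometry.DiscreteGeometry.IsTriangulation`), `v ∈ ω` is interior to `conv ω` and
`{v, z}` is an edge of `K`.  Let `S` be the set of cells (simplices with `4` vertices) of `K`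
containing `v` and `z` (the valence `t_vz` of the edge) and `T` the set of triangles (simplices
with `3` vertices) of `K` containing `v` and `z` (the link vertices `u` of the edge, `σ = {u, v, z}`).
Claim: `#S = #T`.

PROOF (double counting, no metric content beyond the landed two-cells-per-face fact).  Count the
pairs `(t, σ) ∈ S × T` with `σ ⊆ t` in two ways (`Finset.card_mul_eq_card_mul`).
* For `t ∈ S` the triangles `σ ∈ T` inside `t` are the sets `{u, v, z}` with `u` one of the two
  vertices of `t ∖ {v, z}` (these are faces of `K` by down-closure): exactly `2` of them
  (`card_link_triangles`).
* For `σ ∈ T` the cells `t ∈ S` containing `σ` are all the cells of `K` through `σ` (a cell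
  through `σ` contains `v, z ∈ σ`), and there are exactly `2` of them by the landed stub
  `ParFiveRecountTwoCells.stub_twoCellsPerFace` (`σ` has the interior vertex `v`).
Hence `#S · 2 = #T · 2`.
-/

noncomputable section

namespace Summit.AtomisticToContinuum.Crystallization.Theorems.ParFiveRecountEdgeValence

open Literature.Geometry.DiscreteGeometry

/-- **The triangles on an edge inside a cell.**  If `t` has `4` elements, among them `v` and
`z ≠ v`, then the `3`-element subsets of `t` containing `v` and `z` (collected in any finset `C`
characterised by this membership condition) number exactly `2`: they are the sets `{u, v, z}` for
`u ∈ t ∖ {v, z}`. [folklore] -/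
theorem card_link_triangles {α : Type*} [DecidableEq α] {t : Finset α} {v z : α} (hzv : z ≠ v)
    (hvt : v ∈ t) (hzt : z ∈ t) (ht4 : t.card = 4) (C : Finset (Finset α))
    (hC : ∀ σ, σ ∈ C ↔ σ ⊆ t ∧ v ∈ σ ∧ z ∈ σ ∧ σ.card = 3) : C.card = 2 := by
  -- the two "free" vertices of `t`
  set E : Finset α := (t.erase v).erase z with hE
  have hE2 : E.card = 2 := by
    rw [hE, Finset.card_erase_of_mem (Finset.mem_erase.2 ⟨hzv, hzt⟩),
      Finset.card_erase_of_mem hvt, ht4]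
  have hmemE : ∀ u, u ∈ E ↔ u ≠ z ∧ u ≠ v ∧ u ∈ t := fun u => by
    rw [hE, Finset.mem_erase, Finset.mem_erase]
  -- the cardinality of a genuine triple `{u, v, z}`
  have hcard3 : ∀ u, u ≠ z → u ≠ v → (insert u ({v, z} : Finset α)).card = 3 :=
    fun u huz huv => by
      rw [Finset.card_insert_of_notMem (by simp [huz, huv]), Finset.card_pair hzv.symm]
  rw [← hE2]
  symm
  refine Finset.card_nbij (fun u => insert u ({v, z} : Finset α)) ?_ ?_ ?_
  · -- `u ↦ {u, v, z}` maps `E` into `C`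
    intro u hu
    obtain ⟨huz, huv, hut⟩ := (hmemE u).1 (Finset.mem_coe.1 hu)
    refine Finset.mem_coe.2 ((hC _).2 ⟨?_, by simp, by simp, hcard3 u huz huv⟩)
    exact Finset.insert_subset hut (Finset.insert_subset hvt (Finset.singleton_subset_iff.2 hzt))
  · -- it is injective on `E`
    intro u hu u' hu' huu'
    obtain ⟨huz, huv, -⟩ := (hmemE u).1 (Finset.mem_coe.1 hu)
    have hmem : u ∈ insert u' ({v, z} : Finset α) := by
      rw [← show insert u ({v, z} : Finset α) = insert u' {v, z} from huu']
      exact Finset.mem_insert_self u _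
    rw [Finset.mem_insert, Finset.mem_insert, Finset.mem_singleton] at hmem
    rcases hmem with h | h | h
    · exact h
    · exact absurd h huv
    · exact absurd h huz
  · -- it is onto `C`
    intro σ hσ
    obtain ⟨hσt, hvσ, hzσ, hσ3⟩ := (hC σ).1 (Finset.mem_coe.1 hσ)
    have h1 : ((σ.erase v).erase z).card = 1 := by
      rw [Finset.card_erase_of_mem (Finset.mem_erase.2 ⟨hzv, hzσ⟩), Finset.card_erase_of_mem hvσ,
        hσ3]
    obtain ⟨u, hu⟩ := Finset.card_eq_one.1 h1
    have huσ : u ∈ (σ.erase v).erase z := hu ▸ Finset.mem_singleton_self u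
    rw [Finset.mem_erase, Finset.mem_erase] at huσ
    obtain ⟨huz, huv, huσ⟩ := huσ
    refine ⟨u, Finset.mem_coe.2 ((hmemE u).2 ⟨huz, huv, hσt huσ⟩), ?_⟩
    refine Finset.eq_of_subset_of_card_le ?_ (by rw [hσ3, hcard3 u huz huv])
    exact Finset.insert_subset huσ (Finset.insert_subset hvσ (Finset.singleton_subset_iff.2 hzσ))

/-- **Edge valence equals the size of the edge link** (stub `stub_edgeValence`).  For a
triangulation `K` of the finite site set `ω ⊂ ℝ³`, a site `v` interior to `conv ω` and an edge
`{v, z}` of `K`, the number of cells of `K` containing `v` and `z` equals the number of triangles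
of `K` containing `v` and `z`. -/
theorem stub_edgeValence : ∀ (ω : Finset (EuclideanSpace ℝ (Fin 3))) (K : Geometry.SimplicialComplex ℝ (EuclideanSpace ℝ (Fin 3))), Literature.Geometry.DiscreteGeometry.IsTriangulation (↑ω : Set (EuclideanSpace ℝ (Fin 3))) K → ∀ v ∈ ω, v ∈ interior (convexHull ℝ (↑ω : Set (EuclideanSpace ℝ (Fin 3)))) → ∀ (z : EuclideanSpace ℝ (Fin 3)), z ≠ v → ({v, z} : Finset (EuclideanSpace ℝ (Fin 3))) ∈ K.faces → ∀ (S T : Finset (Finset (EuclideanSpace ℝ (Fin 3)))), (∀ t, t ∈ S ↔ t ∈ K.faces ∧ v ∈ t ∧ z ∈ t ∧ t.card = 4) → (∀ σ, σ ∈ T ↔ σ ∈ K.faces ∧ v ∈ σ ∧ z ∈ σ ∧ σ.card = 3) → S.card = T.card := by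
  classical
  intro ω K hK v _hvω hvint z hzv _hvz S T hS hT
  -- double count the pairs `(t, σ) ∈ S × T` with `σ ⊆ t`
  have key := Finset.card_mul_eq_card_mul
    (r := fun t σ : Finset (EuclideanSpace ℝ (Fin 3)) => σ ⊆ t) (s := S) (t := T) (m := 2)
    (n := 2) ?_ ?_
  · omega
  · -- each cell `t ∈ S` contains exactly two triangles of `T`
    intro t ht
    obtain ⟨htK, hvt, hzt, ht4⟩ := (hS t).1 ht
    refine card_link_triangles hzv hvt hzt ht4 _ fun σ => ?_
    rw [Finset.mem_bipartiteAbove, hT]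
    constructor
    · rintro ⟨⟨-, hvσ, hzσ, hσ3⟩, hσt⟩
      exact ⟨hσt, hvσ, hzσ, hσ3⟩
    · rintro ⟨hσt, hvσ, hzσ, hσ3⟩
      exact ⟨⟨K.down_closed htK hσt ⟨v, hvσ⟩, hvσ, hzσ, hσ3⟩, hσt⟩
  · -- each triangle `σ ∈ T` lies in exactly two cells of `S` (two cells per interior face)
    intro σ hσ
    obtain ⟨hσK, hvσ, hzσ, hσ3⟩ := (hT σ).1 hσ
    refine ParFiveRecountTwoCells.stub_twoCellsPerFace ω K hK σ hσK hσ3 ⟨v, hvσ, hvint⟩ _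
      fun t => ?_
    rw [Finset.mem_bipartiteBelow, hS]
    constructor
    · rintro ⟨⟨htK, -, -, ht4⟩, hσt⟩
      exact ⟨htK, ht4, hσt⟩
    · rintro ⟨htK, ht4, hσt⟩
      exact ⟨⟨htK, hσt hvσ, hσt hzσ, ht4⟩, hσt⟩

end Summit.AtomisticToContinuum.Crystallization.Theorems.ParFiveRecountEdgeValence

end
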